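import Literature.NumberTheory.GaloisRepresentations.LubinTateColemanTraceExpansion
import Literature.NumberTheory.GaloisRepresentations.LubinTateInvariantDifferential
import HarnessLib

/-!
# The first Taylor coefficient along the formal group is the invariant derivative: `C_1(h) = ω_F · h'`

De Shalit, *Iwasawa theory of elliptic curves with complex multiplication* (1987), Ch. I §3.5 / §3.12: the
invariant derivation `D = (1/λ') d/dX` is characterised by `h(X [+] Y) = h(X) + (Dh)(X) · Y + O(Y²)`.  In the
tree's language (`LubinTateColemanTraceExpansion.lean`: `h(F(X,Y)) = Σ_j C_j(h)(X) Y^j`, `C_j = fgTaylor … h j`;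
`LubinTateInvariantDifferential.lean`: `ω_F = invDiff`, `ω_F(Y) = F_X(0, Y)`), this file PROVES

* ★ `map_fgTaylor_one` / `fgTaylor_one`: **`C_1(h) = ω_F · h'`** (`= D h`);
* `map_coinvDiff_eq_map_invDiff` / `coinvDiff_eq_invDiff`: **`F_Y(X, 0) = F_X(0, X)`** — the two invariant
  differentials read off `F` agree (commutativity of `F_f`), so `C_1(h) = F_Y(X,0) · h'` as well.

Method: the `Z¹`-coefficient map `Φ : S⟦Z⟧⟦X⟧ → S⟦X⟧` (a `Φ₀`-derivation, `Φ₀` = "set `Z = 0`") applied to the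
Taylor expansion `h(X [+] Z) = Σ_j ι(C_j(h)) · Z^j` (only `j = 1` survives) and to `h(X [+] Z) = Σ_n h_n (X [+] Z)^n`
(`Φ((X [+] Z)^n) = n X^{n-1} Φ(X [+] Z)`, `Φ(X [+] Z) = ω_F(X)` by the expansion of `Z [+] X = X [+] Z`).
Everything is proved (0 sorry); generic in `(A, S)`, and over `A` itself when `A → S` is injective.

## References

* E. de Shalit, *Iwasawa theory of elliptic curves with complex multiplication* (1987), Ch. I §3.5, §3.12. [deShalit1987]
-/

noncomputable section

open Filter Topology
open scoped PowerSeries.WithPiTopology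

namespace Literature.NumberTheory.GaloisRepresentations

namespace LubinTate

section CoinvDiff

variable {A : Type*} [CommRing A] {π : A} {q : ℕ} (hA : IsLTRing π q) {f : PowerSeries A}
  (hf : IsLTSeries π q f)

/-- `F_Y(X, 0) = Σ_i F_{(i,1)} X^i`, the "other" invariant differential (equal to `ω_F`, see
`coinvDiff_eq_invDiff`). [cite: deShalit1987, Ch. I §3.5] -/
def coinvDiff : PowerSeries A :=
  PowerSeries.mk fun i => MvPowerSeries.coeff (Finsupp.single 0 i + Finsupp.single 1 1) (ltF hA hf)

/-- Coefficients of `coinvDiff` (unfolding). [cite: deShalit1987, Ch. I §3.5] -/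
theorem coeff_coinvDiff (i : ℕ) :
    PowerSeries.coeff i (coinvDiff hA hf) =
      MvPowerSeries.coeff (Finsupp.single 0 i + Finsupp.single 1 1) (ltF hA hf) := by
  rw [coinvDiff, PowerSeries.coeff_mk]

/-- `coinvDiff = C_1(X)`: the first Taylor coefficient of `h = X`. [cite: deShalit1987, Ch. I §3.5] -/
theorem fgTaylor_X_one : fgTaylor hA hf PowerSeries.X 1 = coinvDiff hA hf := by
  ext i
  rw [coeff_fgTaylor, coeff_coinvDiff, PowerSeries.subst_X
    (PowerSeries.HasSubst.of_constantCoeff_zero (constantCoeff_ltF hA hf))]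

end CoinvDiff

section Points

variable {A : Type*} [CommRing A] [UniformSpace A] [DiscreteUniformity A]
variable {S : Type*} [CommRing S] [UniformSpace S] [IsUniformAddGroup S] [IsTopologicalRing S]
  [IsLinearTopology S S] [T2Space S] [CompleteSpace S] [Algebra A S] [ContinuousSMul A S]
variable (M : NilIdeal S) {π : A} {q : ℕ} (hA : IsLTRing π q) {f : PowerSeries A}
  (hf : IsLTSeries π q f)

/-! ### The `Z⁰`- and `Z¹`-coefficient maps `S⟦Z⟧⟦X⟧ → S⟦X⟧` -/

omit [UniformSpace A] [DiscreteUniformity A] [UniformSpace S] [IsUniformAddGroup S] [IsTopologicalRing S]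
  [IsLinearTopology S S] [T2Space S] [CompleteSpace S] [Algebra A S] [ContinuousSMul A S] in
/-- `Φ₀`: set `Z = 0` coefficientwise. [cite: deShalit1987, Ch. I §3.5] -/
theorem coeff_zPhi0 (G : PowerSeries (PowerSeries S)) (i : ℕ) :
    PowerSeries.coeff i (G.map (PowerSeries.constantCoeff (R := S))) =
      PowerSeries.constantCoeff (PowerSeries.coeff i G) := PowerSeries.coeff_map _ _ _

/-- `Φ`: the `Z¹`-coefficient, coefficientwise in `X`, as an additive map `S⟦Z⟧⟦X⟧ → S⟦X⟧`.
[cite: deShalit1987, Ch. I §3.5] -/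
def zPhi : PowerSeries (PowerSeries S) →+ PowerSeries S where
  toFun G := PowerSeries.mk fun i => PowerSeries.coeff 1 (PowerSeries.coeff i G)
  map_zero' := by ext i; simp
  map_add' G H := by ext i; simp

omit [UniformSpace A] [DiscreteUniformity A] [UniformSpace S] [IsUniformAddGroup S] [IsTopologicalRing S]
  [IsLinearTopology S S] [T2Space S] [CompleteSpace S] [Algebra A S] [ContinuousSMul A S] in
/-- Coefficients of `Φ`. [cite: deShalit1987, Ch. I §3.5] -/
theorem coeff_zPhi (G : PowerSeries (PowerSeries S)) (i : ℕ) :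
    PowerSeries.coeff i (zPhi G) = PowerSeries.coeff 1 (PowerSeries.coeff i G) := by
  rw [zPhi, AddMonoidHom.coe_mk, ZeroHom.coe_mk, PowerSeries.coeff_mk]

omit [UniformSpace A] [DiscreteUniformity A] [IsUniformAddGroup S] [IsTopologicalRing S]
  [IsLinearTopology S S] [T2Space S] [CompleteSpace S] [Algebra A S] [ContinuousSMul A S] in
/-- `Φ` is continuous. [cite: deShalit1987, Ch. I §3.5] -/
theorem continuous_zPhi : Continuous (zPhi (S := S)) := by
  refine continuous_pi fun d => ?_
  have e : (fun G : PowerSeries (PowerSeries S) => (zPhi G) d) =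
      fun G => PowerSeries.coeff 1 (PowerSeries.coeff (d ()) G) := by
    funext G
    rfl
  rw [e]
  exact (PowerSeries.WithPiTopology.continuous_coeff S 1).comp
    (PowerSeries.WithPiTopology.continuous_coeff (PowerSeries S) (d ()))

omit [UniformSpace A] [DiscreteUniformity A] [UniformSpace S] [IsUniformAddGroup S] [IsTopologicalRing S]
  [IsLinearTopology S S] [T2Space S] [CompleteSpace S] [Algebra A S] [ContinuousSMul A S] in
/-- **`Φ` is a `Φ₀`-derivation**: `Φ(UV) = Φ₀(U)Φ(V) + Φ(U)Φ₀(V)`. [cite: deShalit1987, Ch. I §3.5] -/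
theorem zPhi_mul (U V : PowerSeries (PowerSeries S)) :
    zPhi (U * V) = U.map (PowerSeries.constantCoeff (R := S)) * zPhi V +
      zPhi U * V.map (PowerSeries.constantCoeff (R := S)) := by
  ext i
  rw [coeff_zPhi, map_add, PowerSeries.coeff_mul, map_sum, PowerSeries.coeff_mul, PowerSeries.coeff_mul,
    ← Finset.sum_add_distrib]
  refine Finset.sum_congr rfl fun x _ => ?_
  rw [PowerSeries.coeff_one_mul, coeff_zPhi, coeff_zPhi, coeff_zPhi0, coeff_zPhi0]
  ring

omit [UniformSpace A] [DiscreteUniformity A] [UniformSpace S] [IsUniformAddGroup S] [IsTopologicalRing S]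
  [IsLinearTopology S S] [T2Space S] [CompleteSpace S] [Algebra A S] [ContinuousSMul A S] in
/-- `Φ(Uⁿ) = n Φ₀(U)^{n-1} Φ(U)`. [cite: deShalit1987, Ch. I §3.5] -/
theorem zPhi_pow (U : PowerSeries (PowerSeries S)) (n : ℕ) :
    zPhi (U ^ n) = (n : PowerSeries S) * (U.map (PowerSeries.constantCoeff (R := S))) ^ (n - 1) * zPhi U := by
  induction n with
  | zero =>
    rw [pow_zero, Nat.cast_zero, zero_mul, zero_mul]
    ext i; rw [coeff_zPhi, PowerSeries.coeff_one, map_zero]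
    split_ifs with h
    · rw [PowerSeries.coeff_one, if_neg one_ne_zero]
    · rw [map_zero]
  | succ n ih =>
    rw [pow_succ, zPhi_mul, ih, map_pow, Nat.add_sub_cancel]
    rcases n with _ | n
    · simp
    · rw [Nat.add_sub_cancel]; push_cast; ring

omit [UniformSpace A] [DiscreteUniformity A] [UniformSpace S] [IsUniformAddGroup S] [IsTopologicalRing S]
  [IsLinearTopology S S] [T2Space S] [CompleteSpace S] [ContinuousSMul A S] in
/-- `Φ(ι(P) · C(Z^j)) = [j = 1] ι(P)` for an `A`-series `P` (constants in `Z`). [cite: deShalit1987, Ch. I §3.5] -/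
theorem zPhi_map_mul_C_X_pow (P : PowerSeries A) (j : ℕ) :
    zPhi ((P.map (algebraMap A (PowerSeries S))) * PowerSeries.C ((PowerSeries.X : PowerSeries S) ^ j)) =
      if j = 1 then P.map (algebraMap A S) else 0 := by
  ext i
  rw [coeff_zPhi, PowerSeries.coeff_mul_C, PowerSeries.coeff_map, IsScalarTower.algebraMap_apply A S (PowerSeries S),
    PowerSeries.algebraMap_eq, PowerSeries.coeff_C_mul_X_pow]
  by_cases hj : j = 1
  · rw [if_pos hj.symm, if_pos hj, PowerSeries.coeff_map]
  · rw [if_neg (Ne.symm hj), if_neg hj, map_zero]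

/-! ### `Φ₀` and `Φ` of the point `X [+] Z` -/

omit [UniformSpace A] [DiscreteUniformity A] [IsUniformAddGroup S] [IsTopologicalRing S] [IsLinearTopology S S]
  [T2Space S] [CompleteSpace S] [Algebra A S] [ContinuousSMul A S] in
/-- The continuous map `S⟦Z⟧⟦X⟧ → S⟦X⟧` setting `Z = 0`. [cite: deShalit1987, Ch. I §3.5] -/
theorem continuous_map_constantCoeff :
    Continuous (fun G : PowerSeries (PowerSeries S) => G.map (PowerSeries.constantCoeff (R := S))) := by
  refine continuous_pi fun d => ?_
  have e : (fun G : PowerSeries (PowerSeries S) => (G.map (PowerSeries.constantCoeff (R := S))) d) =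
      fun G => PowerSeries.constantCoeff (G d) := by
    funext G
    exact MvPowerSeries.coeff_map (PowerSeries.constantCoeff (R := S)) d G
  rw [e]
  exact (PowerSeries.WithPiTopology.continuous_constantCoeff S).comp
    (continuous_apply (A := fun _ : (Unit →₀ ℕ) => PowerSeries S) d)

/-- **`Φ₀(X [+] Z) = X`** (setting `Z = 0` in `X [+] Z` gives `X [+] 0 = X`). [cite: deShalit1987, Ch. I §3.5] -/
theorem map_constantCoeff_tPt_serX :
    (((tPt (seriesNilIdeal M) hA hf (serX M)) : (seriesNilIdeal (seriesNilIdeal M)).toIdeal) :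
        PowerSeries (PowerSeries S)).map (PowerSeries.constantCoeff (R := S)) =
      PowerSeries.X := by
  let ε : PowerSeries (PowerSeries S) →ₐ[A] PowerSeries S :=
    PowerSeries.mapAlgHom ((ccHom (S := S)).restrictScalars A)
  have happ : ∀ G : PowerSeries (PowerSeries S), ε G = G.map (PowerSeries.constantCoeff (R := S)) := fun G => rfl
  have hε : Continuous ε := by
    have : (ε : PowerSeries (PowerSeries S) → PowerSeries S) =
        fun G => G.map (PowerSeries.constantCoeff (R := S)) := funext happ
    rw [this]; exact continuous_map_constantCoeff
  rw [← happ]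
  change ε (evalPt (seriesNilIdeal (seriesNilIdeal M)) (formalGroup hA hf).toPowerSeries
      (formalGroup hA hf).zero_constantCoeff ![serX (seriesNilIdeal M), serC (seriesNilIdeal M) (serX M)] :
        PowerSeries (PowerSeries S)) = PowerSeries.X
  have h := algHom_evalPt (seriesNilIdeal (seriesNilIdeal M)) (seriesNilIdeal M) ε hε
    (formalGroup hA hf).toPowerSeries (formalGroup hA hf).zero_constantCoeff
    ![serX (seriesNilIdeal M), serC (seriesNilIdeal M) (serX M)] ![serX M, serC M 0] (fun i => by
      fin_cases i
      · change ε PowerSeries.X = PowerSeries.X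
        rw [happ, PowerSeries.map_X]
      · change ε (PowerSeries.C (PowerSeries.X : PowerSeries S)) = PowerSeries.C ((0 : M.toIdeal) : S)
        rw [happ, PowerSeries.map_C, PowerSeries.constantCoeff_X, ZeroMemClass.coe_zero])
  rw [h]
  change ((ltAdd (seriesNilIdeal M) hA hf (serX M) (serC M 0) : (seriesNilIdeal M).toIdeal) : PowerSeries S) = _
  rw [serC_zero, ltAdd_zero, coe_serX]

omit [UniformSpace A] [DiscreteUniformity A] [UniformSpace S] [IsUniformAddGroup S] [IsTopologicalRing S]
  [IsLinearTopology S S] [T2Space S] [CompleteSpace S] [Algebra A S] [ContinuousSMul A S] in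
/-- `Φ(monomial n t) = monomial n (coeff₁ t)`. [cite: deShalit1987, Ch. I §3.5] -/
theorem zPhi_monomial (n : ℕ) (t : PowerSeries S) :
    zPhi (PowerSeries.monomial n t) = PowerSeries.monomial n (PowerSeries.coeff 1 t) := by
  ext i
  rw [coeff_zPhi, PowerSeries.coeff_monomial, PowerSeries.coeff_monomial]
  split_ifs with h
  · rfl
  · rw [map_zero]

omit [UniformSpace A] [DiscreteUniformity A] [UniformSpace S] [IsUniformAddGroup S] [IsTopologicalRing S]
  [IsLinearTopology S S] [T2Space S] [CompleteSpace S] [ContinuousSMul A S] in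
/-- `Φ` is `A`-linear. [cite: deShalit1987, Ch. I §3.5] -/
theorem zPhi_smul (c : A) (G : PowerSeries (PowerSeries S)) : zPhi (c • G) = c • zPhi G := by
  ext i
  rw [PowerSeries.algebra_smul_eq_C_mul, PowerSeries.algebra_smul_eq_C_mul, coeff_zPhi, PowerSeries.coeff_C_mul,
    PowerSeries.coeff_C_mul, coeff_zPhi, IsScalarTower.algebraMap_apply A S (PowerSeries S),
    PowerSeries.algebraMap_eq, PowerSeries.coeff_C_mul]

/-- **`Φ(X [+] Z) = ι ω_F`**: the `Z¹`-coefficient of `X [+] Z = Z [+] X = F(Z, X)` is `Σ_i F_{(1,i)} X^i`.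
[cite: deShalit1987, Ch. I §3.5] -/
theorem zPhi_tPt_serX :
    zPhi (((tPt (seriesNilIdeal M) hA hf (serX M)) : (seriesNilIdeal (seriesNilIdeal M)).toIdeal) :
        PowerSeries (PowerSeries S)) = (invDiff hA hf).map (algebraMap A S) := by
  classical
  -- `X [+] Z = Z [+] X = F(C Z, X)`
  have hcomm : tPt (seriesNilIdeal M) hA hf (serX M) =
      ltAdd (seriesNilIdeal (seriesNilIdeal M)) hA hf (serC (seriesNilIdeal M) (serX M))
        (serX (seriesNilIdeal M)) :=
    ltAdd_comm _ hA hf _ _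
  have e0 : ((tPt (seriesNilIdeal M) hA hf (serX M) : (seriesNilIdeal (seriesNilIdeal M)).toIdeal) :
      PowerSeries (PowerSeries S)) =
      MvPowerSeries.aeval ((seriesNilIdeal (seriesNilIdeal M)).hasEval
        ![serC (seriesNilIdeal M) (serX M), serX (seriesNilIdeal M)]) (ltF hA hf) := by
    rw [hcomm]; rfl
  have hsum := MvPowerSeries.hasSum_aeval ((seriesNilIdeal (seriesNilIdeal M)).hasEval
    ![serC (seriesNilIdeal M) (serX M), serX (seriesNilIdeal M)]) (ltF hA hf)
  rw [← e0] at hsum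
  have h1 := hsum.map (zPhi (S := S)) continuous_zPhi
  -- the terms: `Φ(F_d • (C Z)^{d 0} X^{d 1}) = [d 0 = 1] monomial (d 1) (ι F_d)`
  have hterm : ∀ d : Fin 2 →₀ ℕ,
      zPhi (MvPowerSeries.coeff d (ltF hA hf) •
        d.prod fun s e => (((![serC (seriesNilIdeal M) (serX M), serX (seriesNilIdeal M)] s :
          (seriesNilIdeal (seriesNilIdeal M)).toIdeal) : PowerSeries (PowerSeries S))) ^ e) =
      if d 0 = 1 then PowerSeries.monomial (d 1) (algebraMap A S (MvPowerSeries.coeff d (ltF hA hf))) else 0 := by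
    intro d
    rw [Finsupp.prod_fintype _ _ (fun i => pow_zero _), Fin.prod_univ_two, Matrix.cons_val_zero,
      Matrix.cons_val_one, Matrix.cons_val_fin_one, coe_serX, coe_serC, coe_serX, ← map_pow,
      PowerSeries.algebra_smul_eq_C_mul, IsScalarTower.algebraMap_apply A S (PowerSeries S),
      PowerSeries.algebraMap_eq, ← mul_assoc, ← map_mul, C_mul_X_pow_eq_monomial, zPhi_monomial,
      PowerSeries.coeff_C_mul_X_pow]
    by_cases hd : d 0 = 1
    · rw [if_pos hd.symm, if_pos hd]
    · rw [if_neg (Ne.symm hd), if_neg hd, map_zero]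
  have hcomp : ((zPhi (S := S)) ∘ fun d : Fin 2 →₀ ℕ => MvPowerSeries.coeff d (ltF hA hf) •
        d.prod fun s e => (((![serC (seriesNilIdeal M) (serX M), serX (seriesNilIdeal M)] s :
          (seriesNilIdeal (seriesNilIdeal M)).toIdeal) : PowerSeries (PowerSeries S))) ^ e) =
      fun d => if d 0 = 1 then PowerSeries.monomial (d 1) (algebraMap A S (MvPowerSeries.coeff d (ltF hA hf)))
        else 0 := funext fun d => hterm d
  rw [hcomp] at h1
  -- re-index along `i ↦ (1, i)` and compare with the monomial expansion of `ι ω_F`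
  let emb : ℕ → (Fin 2 →₀ ℕ) := fun i => Finsupp.single 0 1 + Finsupp.single 1 i
  have hemb0 : ∀ i, emb i 0 = 1 := fun i => by simp [emb]
  have hemb1 : ∀ i, emb i 1 = i := fun i => by simp [emb]
  have hinj : Function.Injective emb := fun i j h => by
    have := congrArg (fun d : Fin 2 →₀ ℕ => d 1) h
    simpa [hemb1] using this
  have hzero : ∀ d ∉ Set.range emb,
      (if d 0 = 1 then PowerSeries.monomial (d 1) (algebraMap A S (MvPowerSeries.coeff d (ltF hA hf))) else 0) =
        0 := by
    intro d hd
    rw [if_neg]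
    intro hd0
    refine hd ⟨d 1, Finsupp.ext fun k => ?_⟩
    fin_cases k
    · exact (hemb0 _).trans hd0.symm
    · exact hemb1 _
  have h3 := (hinj.hasSum_iff hzero).mpr h1
  have h4 : ((fun d : Fin 2 →₀ ℕ => if d 0 = 1 then
      PowerSeries.monomial (d 1) (algebraMap A S (MvPowerSeries.coeff d (ltF hA hf))) else 0) ∘ emb) =
      fun i : ℕ => PowerSeries.monomial i (PowerSeries.coeff i ((invDiff hA hf).map (algebraMap A S))) := by
    funext i
    simp only [Function.comp_apply, hemb0, hemb1, if_true, PowerSeries.coeff_map, coeff_invDiff]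
    rfl
  rw [h4] at h3
  exact h3.unique (PowerSeries.hasSum_of_monomials_self _)

/-! ### `C_1(h) = ω_F · h'` -/

omit [UniformSpace A] [DiscreteUniformity A] [UniformSpace S] [IsUniformAddGroup S] [IsTopologicalRing S]
  [IsLinearTopology S S] [T2Space S] [CompleteSpace S] [ContinuousSMul A S] in
/-- `d⁄dX` commutes with coefficientwise maps (private copy). [folklore] -/
private theorem derivative_map'' (G : PowerSeries A) :
    PowerSeries.derivative S (G.map (algebraMap A S)) = (PowerSeries.derivative A G).map (algebraMap A S) := by
  ext n
  simp only [PowerSeries.coeff_derivative, PowerSeries.coeff_map, map_mul, map_add, map_natCast, map_one]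

omit [UniformSpace A] [DiscreteUniformity A] [UniformSpace S] [IsUniformAddGroup S] [IsTopologicalRing S]
  [IsLinearTopology S S] [T2Space S] [CompleteSpace S] [Algebra A S] [ContinuousSMul A S] in
/-- `d⁄dX (monomial n a) = n X^{n-1} · C a`. [folklore] -/
private theorem derivative_monomial (n : ℕ) (a : S) :
    PowerSeries.derivative S (PowerSeries.monomial n a) =
      PowerSeries.C a * ((n : PowerSeries S) * PowerSeries.X ^ (n - 1)) := by
  rw [← C_mul_X_pow_eq_monomial, (PowerSeries.derivative S).leibniz, PowerSeries.derivative_C, smul_zero, add_zero,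
    PowerSeries.derivative_pow, PowerSeries.derivative_X, mul_one, smul_eq_mul]

/-- **`Φ(h(X [+] Z)) = ι(h') · ι(ω_F)`** (from `h(X [+] Z) = Σ h_n (X [+] Z)^n`, `Φ((X[+]Z)^n) = n X^{n-1} ι ω_F`).
[cite: deShalit1987, Ch. I §3.5] -/
theorem zPhi_transl_serX (h : PowerSeries A) :
    zPhi (transl (seriesNilIdeal M) hA hf (serX M) h) =
      (PowerSeries.derivative A h).map (algebraMap A S) * (invDiff hA hf).map (algebraMap A S) := by
  set U : PowerSeries (PowerSeries S) :=
    ((tPt (seriesNilIdeal M) hA hf (serX M) : (seriesNilIdeal (seriesNilIdeal M)).toIdeal) :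
      PowerSeries (PowerSeries S)) with hU
  set W : PowerSeries S := (invDiff hA hf).map (algebraMap A S) with hW
  have ht : IsTopologicallyNilpotent U :=
    (seriesNilIdeal (seriesNilIdeal M)).isTopologicallyNilpotent _ (tPt (seriesNilIdeal M) hA hf (serX M)).2
  -- `h(X [+] Z) = Σ h_n U^n`, then apply `Φ`
  have hsum : HasSum (fun n : ℕ => PowerSeries.coeff n h • U ^ n) (transl (seriesNilIdeal M) hA hf (serX M) h) :=
    PowerSeries.hasSum_aeval ht h
  have h1 := hsum.map (zPhi (S := S)) continuous_zPhi
  have hterm : ∀ n : ℕ, zPhi (PowerSeries.coeff n h • U ^ n) =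
      PowerSeries.coeff n h • (((n : PowerSeries S) * PowerSeries.X ^ (n - 1)) * W) := by
    intro n
    rw [zPhi_smul, zPhi_pow, hU, map_constantCoeff_tPt_serX, zPhi_tPt_serX]
  have hcomp : ((zPhi (S := S)) ∘ fun n : ℕ => PowerSeries.coeff n h • U ^ n) =
      fun n => PowerSeries.coeff n h • (((n : PowerSeries S) * PowerSeries.X ^ (n - 1)) * W) :=
    funext fun n => hterm n
  rw [hcomp] at h1
  -- `Σ h_n n X^{n-1} = ι(h')`
  have h2 : HasSum (fun n : ℕ => PowerSeries.coeff n h • (((n : PowerSeries S) * PowerSeries.X ^ (n - 1)) * W))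
      ((PowerSeries.derivative A h).map (algebraMap A S) * W) := by
    have h3 := (PowerSeries.hasSum_of_monomials_self (h.map (algebraMap A S))).map
      (PowerSeries.derivative S).toLinearMap.toAddMonoidHom PowerSeries.continuous_derivative
    have key : HasSum (fun n : ℕ => PowerSeries.derivative S
        (PowerSeries.monomial n (PowerSeries.coeff n (h.map (algebraMap A S)))) * W)
        (PowerSeries.derivative S (h.map (algebraMap A S)) * W) := h3.mul_right W
    rw [derivative_map''] at key
    have e : (fun n : ℕ => PowerSeries.derivative S
        (PowerSeries.monomial n (PowerSeries.coeff n (h.map (algebraMap A S)))) * W) =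
        fun n => PowerSeries.coeff n h • (((n : PowerSeries S) * PowerSeries.X ^ (n - 1)) * W) := by
      funext n
      rw [derivative_monomial, PowerSeries.coeff_map, PowerSeries.algebra_smul_eq_C_mul, mul_assoc]
    rw [e] at key
    exact key
  exact h1.unique h2

/-- **`Φ(h(X [+] Z)) = ι(C_1(h))`** (from the Taylor expansion `h(X [+] Z) = Σ_j ι(C_j(h)) Z^j`).
[cite: deShalit1987, Ch. I §3.12] -/
theorem zPhi_transl_serX_eq_fgTaylor (h : PowerSeries A) :
    zPhi (transl (seriesNilIdeal M) hA hf (serX M) h) = (fgTaylor hA hf h 1).map (algebraMap A S) := by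
  have h1 := (hasSum_fgTaylor_transl (seriesNilIdeal M) hA hf (serX M) h).map (zPhi (S := S)) continuous_zPhi
  have hcomp : ((zPhi (S := S)) ∘ fun j : ℕ => (fgTaylor hA hf h j).map (algebraMap A (PowerSeries S)) *
      PowerSeries.C ((((serX M : (seriesNilIdeal M).toIdeal)) : PowerSeries S) ^ j)) =
      fun j => if j = 1 then (fgTaylor hA hf h 1).map (algebraMap A S) else 0 := by
    funext j
    rw [Function.comp_apply, coe_serX, zPhi_map_mul_C_X_pow]
    split_ifs with hj
    · rw [hj]
    · rfl
  rw [hcomp] at h1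
  have h2 : HasSum (fun j : ℕ => if j = 1 then (fgTaylor hA hf h 1).map (algebraMap A S) else 0)
      ((fgTaylor hA hf h 1).map (algebraMap A S)) := by
    have := hasSum_single (f := fun j : ℕ => if j = 1 then (fgTaylor hA hf h 1).map (algebraMap A S) else 0) 1
      (fun j hj => if_neg hj)
    simpa using this
  exact h1.unique h2

/-- ★★ **`C_1(h) = ω_F · h'`** in `S⟦X⟧: the first Taylor coefficient of `h` along `F_f` is the invariant derivative
`D h = ω_F · h'`. [cite: deShalit1987, Ch. I §3.5] -/
theorem map_fgTaylor_one (h : PowerSeries A) :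
    (fgTaylor hA hf h 1).map (algebraMap A S) = (invDiff hA hf * PowerSeries.derivative A h).map (algebraMap A S) := by
  rw [← zPhi_transl_serX_eq_fgTaylor (botNilIdeal S) hA hf h, zPhi_transl_serX, map_mul, mul_comm]

/-- **`F_Y(X,0) = F_X(0,X)`** in `S⟦X⟧ (commutativity of `F_f`): the two invariant differentials agree.
[cite: deShalit1987, Ch. I §3.5] -/
theorem map_coinvDiff_eq_map_invDiff :
    (coinvDiff hA hf).map (algebraMap A S) = (invDiff hA hf).map (algebraMap A S) := by
  rw [← fgTaylor_X_one, map_fgTaylor_one, PowerSeries.derivative_X, mul_one]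

/-- `C_1(h) = ω_F · h'` over `A`, when `A` embeds in the point algebra `S`. [cite: deShalit1987, Ch. I §3.5] -/
theorem fgTaylor_one (hinj : Function.Injective (algebraMap A S)) (h : PowerSeries A) :
    fgTaylor hA hf h 1 = invDiff hA hf * PowerSeries.derivative A h :=
  PowerSeries.map_injective (algebraMap A S) hinj (map_fgTaylor_one (S := S) hA hf h)

/-- `F_Y(X,0) = F_X(0,X)` over `A`, when `A` embeds in `S`. [cite: deShalit1987, Ch. I §3.5] -/
theorem coinvDiff_eq_invDiff (hinj : Function.Injective (algebraMap A S)) : coinvDiff hA hf = invDiff hA hf :=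
  PowerSeries.map_injective (algebraMap A S) hinj (map_coinvDiff_eq_map_invDiff (S := S) hA hf)

end Points

/-! ### At `q = 2`: the trace operator modulo `π²` -/

section LocalFieldTwo

open GaloisRepresentations.IsNonarchimedeanLocalField ValuativeRel

variable (F : Type*) [Field F] [ValuativeRel F] [TopologicalSpace F] [IsNonarchimedeanLocalField F]

attribute [local instance] ltNormUniformSpace ltNormIsUniformAddGroup rk1 nF nE fintypeResidueField

variable {F}
variable {π : 𝒪[F]} (hπ : (valuation F).IsUniformizer (π : F)) (n : ℕ)

/-- Balls of `𝒪_E` are closed (they are open additive subgroups). [folklore] -/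
private theorem isClosed_ballIdeal (E : IntermediateField F (AlgebraicClosure F)) [FiniteDimensional F E]
    {ε : ℝ} (hε : 0 < ε) : IsClosed ((ballIdeal E hε : Ideal (unitBall E)) : Set (unitBall E)) := by
  have hopen : IsOpen ((ballIdeal E hε : Ideal (unitBall E)) : Set (unitBall E)) := by
    have : ((ballIdeal E hε : Ideal (unitBall E)) : Set (unitBall E)) =
        (fun x : unitBall E => (x : E)) ⁻¹' Metric.ball 0 ε := by
      ext x; simp [ballIdeal, Metric.mem_ball, dist_zero_right]
    rw [this]
    exact Metric.isOpen_ball.preimage continuous_subtype_val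
  exact (ballIdeal E hε).toAddSubgroup.isClosed_of_isOpen hopen

/-- `C_1(h) = ω_F · h'` over `𝒪[F]`. [cite: deShalit1987, Ch. I §3.5] -/
theorem fgTaylor_one_LTCoeff (h : PowerSeries (LTCoeff F)) :
    fgTaylor (isLTRing_LTCoeff hπ) (isLTSeries_LTCoeff π) h 1 =
      invDiff (isLTRing_LTCoeff hπ) (isLTSeries_LTCoeff π) * PowerSeries.derivative (LTCoeff F) h :=
  fgTaylor_one (S := unitBall (ltField π 0)) _ _ (algebraMap_LTCoeff_injective (ltField π 0)) h

/-- ★★ **The trace operator modulo `π²` when `q = 2`** (e.g. `F = ℚ₂`): for every `h ∈ 𝒪[F]⟦X⟧`,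
`(𝒮h) ∘ f ≡ 2h − π · ω_F · h' (mod π²)`, i.e. `(π⁻¹𝒮 h) ∘ f ≡ (2/π)·h − D h (mod π)` — the `f = πX + X²`
analogue of de Shalit's computation of `𝒮` modulo `𝔭'` (I §3.12). [cite: deShalit1987, Ch. I §3.12] -/
theorem subst_colemanTrace_sub_mem_coeffIdeal_sq (hq : residueFieldCard F = 2) (h : PowerSeries (LTCoeff F)) :
    PowerSeries.subst (ltSer F π) (colemanTrace hπ n h) -
        ((2 : PowerSeries (LTCoeff F)) * h - PowerSeries.C (LTCoeff.of F π) *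
          (invDiff (isLTRing_LTCoeff hπ) (isLTSeries_LTCoeff π) * PowerSeries.derivative (LTCoeff F) h)) ∈
      coeffIdeal (Ideal.span {LTCoeff.of F π ^ 2}) := by
  classical
  set S := unitBall (ltField π n) with hS
  set ι : LTCoeff F →+* S := algebraMap (LTCoeff F) S with hι
  set hA := isLTRing_LTCoeff (F := F) hπ
  set hf := isLTSeries_LTCoeff (F := F) π
  set G : PowerSeries (LTCoeff F) := PowerSeries.subst (ltSer F π) (colemanTrace hπ n h) -
    ((2 : PowerSeries (LTCoeff F)) * h - PowerSeries.C (LTCoeff.of F π) *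
      (invDiff hA hf * PowerSeries.derivative (LTCoeff F) h)) with hG
  have hπS : ι (LTCoeff.of F π) = algebraMap 𝒪[F] S π := rfl
  have hπnorm : ‖((ι (LTCoeff.of F π) : S) : ltField π n)‖ = ‖(π : F)‖ := norm_algebraMap_LTCoeff (ltField π n) π
  have hπpos : 0 < ‖(π : F)‖ := norm_pos_iff.mpr hπ.ne_zero
  have hπlt : ‖(π : F)‖ < 1 := (Valued.toNormedField.norm_lt_one_iff).mpr hπ.val_lt_one
  -- the expansion `ι((𝒮h)∘f) = Σ_j ι(C_j) · s_j`, `s_0 = 2`, `s_{m+1} = (-π)^{m+1}`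
  set T : ℕ → PowerSeries S := fun j => (fgTaylor hA hf h j).map ι * PowerSeries.C (divPtPowerSum hπ n j) with hT
  have hsum : HasSum T (PowerSeries.map ι (PowerSeries.subst (ltSer F π) (colemanTrace hπ n h))) :=
    hasSum_fgTaylor_colemanTrace hπ n h
  have hT0 : T 0 = PowerSeries.map ι ((2 : PowerSeries (LTCoeff F)) * h) := by
    rw [hT]
    change (fgTaylor hA hf h 0).map ι * PowerSeries.C (divPtPowerSum hπ n 0) = _
    rw [fgTaylor_zero, divPtPowerSum_zero, hq, map_mul, map_ofNat, Nat.cast_ofNat, mul_comm, ← map_ofNat PowerSeries.C 2]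
  have hT1 : T 1 = -PowerSeries.map ι (PowerSeries.C (LTCoeff.of F π) *
      (invDiff hA hf * PowerSeries.derivative (LTCoeff F) h)) := by
    rw [hT]
    change (fgTaylor hA hf h 1).map ι * PowerSeries.C (divPtPowerSum hπ n 1) = _
    rw [map_fgTaylor_one, divPtPowerSum_one, if_pos hq, map_neg, mul_neg, ← hπS, ← PowerSeries.map_C ι, ← map_mul,
      mul_comm (invDiff hA hf * _) (PowerSeries.C _)]
  have hsum2 := (hasSum_nat_add_iff' 2).mpr hsum
  rw [Finset.sum_range_succ, Finset.sum_range_one, hT0, hT1] at hsum2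
  have hlim : PowerSeries.map ι (PowerSeries.subst (ltSer F π) (colemanTrace hπ n h)) -
      (PowerSeries.map ι ((2 : PowerSeries (LTCoeff F)) * h) +
        -PowerSeries.map ι (PowerSeries.C (LTCoeff.of F π) * (invDiff hA hf * PowerSeries.derivative (LTCoeff F) h))) =
      PowerSeries.map ι G := by
    rw [hG, map_sub, map_sub, sub_eq_add_neg ((PowerSeries.map ι) (2 * h))]
  rw [hlim] at hsum2
  -- every term `T (j+2)` has all coefficients of norm `< ‖π‖`
  set J : Ideal S := ballIdeal (ltField π n) hπpos with hJ
  have hterm : ∀ j : ℕ, T (j + 2) ∈ coeffIdeal J := by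
    intro j k
    rw [hT]
    change PowerSeries.coeff k ((fgTaylor hA hf h (j + 2)).map ι * PowerSeries.C (divPtPowerSum hπ n (j + 2))) ∈ J
    rw [PowerSeries.coeff_mul_C, PowerSeries.coeff_map, show j + 2 = (j + 1) + 1 by ring,
      divPtPowerSum_succ_of_residueFieldCard_eq_two hπ n hq (j + 1)]
    change ‖((ι (PowerSeries.coeff k (fgTaylor hA hf h (j + 1 + 1))) *
      (-(algebraMap 𝒪[F] S π)) ^ (j + 1 + 1) : S) : ltField π n)‖ < ‖(π : F)‖
    rw [Subring.coe_mul, norm_mul, SubmonoidClass.coe_pow, norm_pow, Subring.coe_neg, norm_neg, ← hπS, hπnorm]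
    calc ‖((ι (PowerSeries.coeff k (fgTaylor hA hf h (j + 1 + 1))) : S) : ltField π n)‖ * ‖(π : F)‖ ^ (j + 1 + 1)
        ≤ 1 * ‖(π : F)‖ ^ (j + 1 + 1) := by
          gcongr; exact (mem_unitBall_iff (ltField π n)).mp (ι _).2
      _ < ‖(π : F)‖ := by
          rw [one_mul, show j + 1 + 1 = (j + 1) + 1 by ring, pow_succ]
          exact mul_lt_of_lt_one_left hπpos (pow_lt_one₀ hπpos.le hπlt (Nat.succ_ne_zero j))
  have hmem : PowerSeries.map ι G ∈ coeffIdeal J := by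
    refine (isClosed_coeffIdeal (isClosed_ballIdeal (ltField π n) hπpos)).mem_of_tendsto hsum2
      (Filter.Eventually.of_forall fun s => ?_)
    exact Ideal.sum_mem _ fun j _ => hterm j
  -- descend to `𝒪[F]`: coefficients of norm `< ‖π‖` are divisible by `π²`
  intro k
  have hk := hmem k
  rw [PowerSeries.coeff_map] at hk
  change ‖((ι (PowerSeries.coeff k G) : S) : ltField π n)‖ < ‖(π : F)‖ at hk
  have hk' : ‖(((LTCoeff.of F).symm (PowerSeries.coeff k G) : 𝒪[F]) : F)‖ < ‖(π : F)‖ ^ 1 := by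
    rw [pow_one, ← norm_algebraMap_LTCoeff (ltField π n)]
    exact hk
  rw [Ideal.mem_span_singleton]
  exact pow_succ_dvd_of_norm_lt hπ hk'

end LocalFieldTwo

end LubinTate

end Literature.NumberTheory.GaloisRepresentations
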